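import Literature.NumberTheory.Transcendental.AnalytificationChartsProofs
import Literature.NumberTheory.Transcendental.AnalytificationConnected
import Literature.NumberTheory.Transcendental.ZeroLocusConnected
import HarnessLib

/-!
# Connectedness of `X(ℂ)`: reduction to affine varieties in coordinates

Sibling file of `AnalytificationConnected.lean` (SGA1 XII Prop. 2.4 reduced to its irreducible
case `Literature.ComplexPoints.isConnected_setOf_pt_mem_of_isIrreducible X`) and of
`ZeroLocusConnected.lean` (the coordinate fact `Literature.NumberTheory.Transcendental.isConnected_zeroLocus_of_isPrime`:
`V(𝔭) ⊆ ℂⁿ` is connected for `𝔭` prime — Shafarevich's Theorem 7.1 for affine varieties). Here we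
**prove** that the coordinate fact implies the irreducible case, hence `connectedSpace_iff X`,
for every scheme `X` locally of finite type over `ℂ`
(`ComplexPoints.isConnected_setOf_pt_mem_of_isIrreducible_of_zeroLocus`,
`ComplexPoints.connectedSpace_iff_of_isConnected_zeroLocus`). This is the step «it is enough to
prove the theorem for affine `X`» of SGA1 XII Prop. 2.4 / Shafarevich VII §2.3, run on the
tree's description of the strong topology of an affine piece `U(L)` by finitely many coordinates
(Serre, GAGA §2 n°5 Lemme 1: `AlgPoints.isInducing_evalOrZero_val` of
`AnalytificationChartsProofs.lean`).

## Proof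

Let `Z ⊆ X` be closed irreducible, `U ⊆ X` an affine open, `A = Γ(X, U)` (a `k`-algebra through
`SchemeOver.scalarRingHom X U`), and `𝔭 ⊆ A` the ideal of `Z` on `U`, i.e. Mathlib's
`(Scheme.IdealSheafData.vanishingIdeal ⟨Z, hZ⟩).ideal ⟨U, hU⟩`.
* `𝔭` is prime when `Z` meets `U` (`AlgPoints.isPrime_ideal_vanishingIdeal`), and for
  `P ∈ U(L)`, `P.pt ∈ Z ↔ f(P) = 0` for all `f ∈ 𝔭` (`pt_mem_iff_forall_eval_eq_zero`, from
  `Scheme.IdealSheafData.mem_support_iff_of_mem`).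
* `AlgPoints.exists_surjective_aeval`: `A` is generated over `k` by finitely many coordinates
  `x₁, …, xₙ` (`X` locally of finite type), `ψ = aeval x : k[T₁, …, Tₙ] ↠ A`.
* `AlgPoints.image_evalOrZero_subset_zeroLocus` / `image_evalOrZero_eq_zeroLocus`: the coordinate
  map `Q ↦ (xᵢ(Q))ᵢ` sends `Z(L) ∩ U(L)` into `V(J)`, `J = ψ⁻¹(𝔭)`, and for rational points
  (`L = k`) onto it: a zero `z ∈ kⁿ` of `J ⊇ ker ψ` defines a character `χ : A → k` with
  `χ ∘ ψ = ev_z`, the identity on scalars and vanishing on `𝔭`, which is evaluation at a point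
  `P ∈ U(k)` by `U(k) = Hom_k(A, k)` (`AlgPoints.exists_eval_eq`); then `P.pt ∈ Z` and `x(P) = z`.
* Hence `Z(ℂ) ∩ U(ℂ)`, a subspace of `U(ℂ)` whose topology is induced by the coordinates
  (`AlgPoints.isInducing_evalOrZero_val`), is homeomorphic onto `V(J)` with `J` prime: connected
  by the coordinate fact (`ComplexPoints.isPreconnected_setOf_pt_mem_inter`). Finally
  `Z(ℂ) = ⋃_U (Z(ℂ) ∩ U(ℂ))` over the affine opens meeting `Z`, any two of which meet inside the
  irreducible `Z` in a nonempty locally closed set containing a closed point, i.e. a complex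
  point: the union is connected.

## References

* A. Grothendieck, M. Raynaud, *SGA 1*, Exp. XII, Prop. 2.4.
* I. R. Shafarevich, *Basic Algebraic Geometry 2*, Book 3, Ch. VII §2.3 (reduction to the affine
  case), Thm. 7.1.
* J.-P. Serre, *Géométrie algébrique et géométrie analytique*, Ann. Inst. Fourier **6** (1956),
  §2 n°5, Lemme 1.
* D. Mumford, *The Red Book of Varieties and Schemes*, I §10.
-/

noncomputable section

universe u

open CategoryTheory AlgebraicGeometry Topology TopologicalSpace

namespace Literature.NumberTheory.Transcendental

section AlgPoints
open Literature.AlgebraicGeometry.Motives (AlgPoints)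
open Literature.AlgebraicGeometry.Motives.AlgPoints

variable {k : Type u} [Field k] {X : Literature.AlgebraicGeometry.Motives.SchemeOver k} {L : Type u} [Field L] [Algebra k L]

/-! ### Finitely many coordinates on an affine open -/

/-- **Coordinates.** On an affine open `U` of a scheme locally of finite type over `k`, the
`k`-algebra `Γ(X, U)` (scalars `SchemeOver.scalarRingHom X U`) is generated by finitely many
sections `x₁, …, xₙ`: `aeval x : k[T₁, …, Tₙ] → Γ(X, U)` is surjective (Mathlib
`Scheme.Hom.finiteType_appLE`, `Algebra.FiniteType.iff_quotient_mvPolynomial''`; the same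
construction is inlined in `AlgPoints.locallyCompactSpace_subtype_pt_mem`).
[Hartshorne II §3; Serre, GAGA §2 n°5] [folklore] -/
theorem _root_.Literature.AlgebraicGeometry.Motives.AlgPoints.exists_surjective_aeval [LocallyOfFiniteType X.hom] {U : X.left.Opens}
    (hU : IsAffineOpen U) [Algebra k Γ(X.left, U)]
    (halg : ∀ c, algebraMap k Γ(X.left, U) c = Literature.AlgebraicGeometry.Motives.SchemeOver.scalarRingHom X U c) :
    ∃ (n : ℕ) (x : Fin n → Γ(X.left, U)),
      Function.Surjective (MvPolynomial.aeval x : MvPolynomial (Fin n) k →ₐ[k] Γ(X.left, U)) := by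
  have h1 : (X.hom.appLE ⊤ U le_top).hom.FiniteType :=
    X.hom.finiteType_appLE (isAffineOpen_top _) hU le_top
  have h2 : (Scheme.ΓSpecIso (.of k)).inv.hom.FiniteType :=
    RingHom.FiniteType.of_surjective _
      (Scheme.ΓSpecIso (.of k)).symm.commRingCatIsoToRingEquiv.surjective
  have h3 : (algebraMap k Γ(X.left, U)).FiniteType := by
    rw [show algebraMap k Γ(X.left, U) = Literature.AlgebraicGeometry.Motives.SchemeOver.scalarRingHom X U from RingHom.ext halg]
    exact h1.comp h2
  haveI : Algebra.FiniteType k Γ(X.left, U) := RingHom.finiteType_algebraMap.mp h3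
  obtain ⟨n, f, hf⟩ := Algebra.FiniteType.iff_quotient_mvPolynomial''.mp ‹_›
  refine ⟨n, fun i ↦ f (MvPolynomial.X i), ?_⟩
  have : (MvPolynomial.aeval fun i ↦ f (MvPolynomial.X i)) = f := (MvPolynomial.aeval_unique f).symm
  rw [this]
  exact hf

/-! ### The ideal of a closed subset on an affine open (Mathlib's vanishing ideal sheaf) -/

section VanishingIdeal

variable {U : X.left.Opens} (hU : IsAffineOpen U) {Z : Set X.left} (hZ : IsClosed Z)

/-- The ideal of an irreducible closed subset `Z` meeting the affine open `U` — the `U`-component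
`(Scheme.IdealSheafData.vanishingIdeal ⟨Z, hZ⟩).ideal ⟨U, hU⟩` of Mathlib's vanishing ideal sheaf
of `Z`, i.e. the vanishing ideal of `fromSpec⁻¹(Z) ⊆ Spec Γ(X, U)` — is prime.
[Hartshorne II Cor. 5.10; Prop. 3.1] [folklore] -/
theorem _root_.Literature.AlgebraicGeometry.Motives.AlgPoints.isPrime_ideal_vanishingIdeal (hZ' : IsIrreducible Z)
    (hZU : (Z ∩ (U : Set X.left)).Nonempty) :
    ((Scheme.IdealSheafData.vanishingIdeal ⟨Z, hZ⟩).ideal ⟨U, hU⟩).IsPrime := by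
  rw [Scheme.IdealSheafData.vanishingIdeal_ideal,
    ← PrimeSpectrum.isIrreducible_iff_vanishingIdeal_isPrime]
  refine ⟨?_, hZ'.2.preimage hU.fromSpec.isOpenEmbedding⟩
  obtain ⟨y, hyZ, hyU⟩ := hZU
  rw [← hU.range_fromSpec] at hyU
  obtain ⟨m, rfl⟩ := hyU
  exact ⟨m, hyZ⟩

/-- Membership in a closed `Z` is tested by the functions of its ideal on an affine open
`U ∋ P.pt` (Mathlib `Scheme.IdealSheafData.mem_support_iff_of_mem`, `coe_support_vanishingIdeal`):
for `P ∈ U(L)`, `P.pt ∈ Z ↔ f(P) = 0` for all `f` in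
`(Scheme.IdealSheafData.vanishingIdeal ⟨Z, hZ⟩).ideal ⟨U, hU⟩`. [Hartshorne II §2, Cor. 5.10]
[folklore] -/
theorem _root_.Literature.AlgebraicGeometry.Motives.AlgPoints.pt_mem_iff_forall_eval_eq_zero (P : AlgPoints X L) (h : P.pt ∈ U) :
    P.pt ∈ Z ↔ ∀ f ∈ (Scheme.IdealSheafData.vanishingIdeal ⟨Z, hZ⟩).ideal ⟨U, hU⟩,
      P.eval U h f = 0 := by
  have key : P.pt ∈ Z ↔ P.pt ∈ (Scheme.IdealSheafData.vanishingIdeal ⟨Z, hZ⟩).support := by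
    rw [← SetLike.mem_coe, Scheme.IdealSheafData.coe_support_vanishingIdeal]
    rfl
  rw [key, Scheme.IdealSheafData.mem_support_iff_of_mem (U := ⟨U, hU⟩) h,
    Scheme.mem_zeroLocus_iff]
  refine forall₂_congr fun f _ ↦ ?_
  rw [P.pt_mem_basicOpen_iff h f, not_not]

end VanishingIdeal

/-! ### The coordinate image of `Z(L) ∩ U(L)` -/

section Coord

variable {U : X.left.Opens} {ι : Type*} [Algebra k Γ(X.left, U)]
  (halg : ∀ c, algebraMap k Γ(X.left, U) c = Literature.AlgebraicGeometry.Motives.SchemeOver.scalarRingHom X U c)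
include halg

/-- The image of `Z(L) ∩ U(L)` under the coordinate map `Q ↦ (xᵢ(Q))ᵢ` of a family
`x : ι → Γ(X, U)` lies in `V(J)`, `J = ψ⁻¹(𝔭)` the preimage under `ψ = aeval x : k[Tᵢ] → Γ(X, U)`
of the ideal of `Z` on `U` (values of polynomial expressions: `AlgPoints.eval_aeval_eq_eval_map`).
[Serre, GAGA §2 n°5] [folklore] -/
theorem _root_.Literature.AlgebraicGeometry.Motives.AlgPoints.image_evalOrZero_subset_zeroLocus (hU : IsAffineOpen U) (x : ι → Γ(X.left, U))
    {Z : Set X.left} (hZ : IsClosed Z) :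
    (fun (Q : {Q : AlgPoints X L // Q.pt ∈ U}) i ↦ evalOrZero U (x i) Q.1) '' {Q | Q.1.pt ∈ Z} ⊆
      MvPolynomial.zeroLocus L
        (((Scheme.IdealSheafData.vanishingIdeal ⟨Z, hZ⟩).ideal ⟨U, hU⟩).comap
          (MvPolynomial.aeval x : MvPolynomial ι k →ₐ[k] Γ(X.left, U))) := by
  rintro _ ⟨Q, hQ, rfl⟩
  simp only [MvPolynomial.mem_zeroLocus_iff]
  intro p hp
  rw [Ideal.mem_comap] at hp
  have := (pt_mem_iff_forall_eval_eq_zero hU hZ Q.1 Q.2).mp hQ _ hp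
  rw [eval_aeval_eq_eval_map halg x Q.2 p] at this
  rwa [MvPolynomial.aeval_def, ← MvPolynomial.eval_map]

omit [Algebra k L] in
/-- **The coordinate image of `Z(k) ∩ U(k)` is `V(J)`.** For `U` an affine open with generating
coordinates `x₁, …, xₙ` (`ψ = aeval x : k[T] → Γ(X, U)` onto) and `Z ⊆ X` closed with ideal `𝔭`
on `U`, the coordinate map sends `{P ∈ U(k) | P.pt ∈ Z}` onto the zero set in `kⁿ` of
`J = ψ⁻¹(𝔭)`: a zero `z ∈ kⁿ` of `J ⊇ ker ψ` defines a character `χ : Γ(X, U) → k` with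
`χ ∘ ψ = ev_z`, which is the identity on scalars and kills `𝔭`; by `U(k) = Hom_k(Γ(X, U), k)`
(`AlgPoints.exists_eval_eq`) `χ` is evaluation at a point `P ∈ U(k)`, which lies in `Z`
(`𝔭 ⊆ ker χ`) and has coordinates `z`. [Serre, GAGA §2 n°5; Mumford, *Red Book* I §10]
[folklore] -/
theorem _root_.Literature.AlgebraicGeometry.Motives.AlgPoints.image_evalOrZero_eq_zeroLocus (hU : IsAffineOpen U) {x : ι → Γ(X.left, U)}
    (hx : Function.Surjective (MvPolynomial.aeval x : MvPolynomial ι k →ₐ[k] Γ(X.left, U)))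
    {Z : Set X.left} (hZ : IsClosed Z) :
    (fun (Q : {Q : AlgPoints X k // Q.pt ∈ U}) i ↦ evalOrZero U (x i) Q.1) '' {Q | Q.1.pt ∈ Z} =
      MvPolynomial.zeroLocus k
        (((Scheme.IdealSheafData.vanishingIdeal ⟨Z, hZ⟩).ideal ⟨U, hU⟩).comap
          (MvPolynomial.aeval x : MvPolynomial ι k →ₐ[k] Γ(X.left, U))) := by
  refine subset_antisymm (image_evalOrZero_subset_zeroLocus halg hU x hZ) fun z hz ↦ ?_
  let ψ : MvPolynomial ι k →+* Γ(X.left, U) :=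
    (MvPolynomial.aeval x : MvPolynomial ι k →ₐ[k] Γ(X.left, U)).toRingHom
  have hψ : Function.Surjective ψ := hx
  rw [MvPolynomial.mem_zeroLocus_iff] at hz
  have hz' : ∀ p, MvPolynomial.aeval x p ∈
      (Scheme.IdealSheafData.vanishingIdeal ⟨Z, hZ⟩).ideal ⟨U, hU⟩ →
      MvPolynomial.eval z p = 0 := fun p hp ↦ hz p (Ideal.mem_comap.mpr hp)
  -- the character `χ : Γ(X, U) → k` defined by `z`
  have hle : RingHom.ker ψ ≤ RingHom.ker (MvPolynomial.eval z) := fun p hp ↦ by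
    rw [RingHom.mem_ker] at hp ⊢
    refine hz' p ?_
    rw [show MvPolynomial.aeval x p = ψ p from rfl, hp]
    exact Ideal.zero_mem _
  let χ : Γ(X.left, U) →+* k := ψ.liftOfSurjective hψ ⟨MvPolynomial.eval z, hle⟩
  have hχψ : ∀ p, χ (MvPolynomial.aeval x p) = MvPolynomial.eval z p := fun p ↦
    ψ.liftOfSurjective_comp_apply hψ ⟨MvPolynomial.eval z, hle⟩ p
  have hχc : ∀ c : k, χ (Literature.AlgebraicGeometry.Motives.SchemeOver.scalarRingHom X U c) = algebraMap k k c := fun c ↦ by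
    rw [← halg, ← MvPolynomial.algHom_C (MvPolynomial.aeval x) c, hχψ, MvPolynomial.eval_C,
      Algebra.algebraMap_self, RingHom.id_apply]
  -- `χ` is evaluation at a point `P ∈ U(k)`
  obtain ⟨P, hPU, hev⟩ := exists_eval_eq (L := k) hU χ (RingHom.ext hχc)
  refine ⟨⟨P, hPU⟩, ?_, ?_⟩
  · -- `P.pt ∈ Z` since `χ` kills `𝔭`
    change P.pt ∈ Z
    rw [pt_mem_iff_forall_eval_eq_zero hU hZ P hPU]
    intro f hf
    obtain ⟨p, rfl⟩ := hx f
    rw [hev, hχψ]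
    exact hz' p hf
  · funext i
    change evalOrZero U (x i) P = z i
    rw [evalOrZero_of_mem _ hPU, hev,
      ← MvPolynomial.aeval_X (R := k) (S₁ := Γ(X.left, U)) x i, hχψ, MvPolynomial.eval_X]

end Coord

end AlgPoints

/-! ### Complex points: connectedness of `Z(ℂ)` from the coordinate fact -/

section ComplexPoints
open Literature.AlgebraicGeometry.Motives (ComplexPoints)
open Literature.AlgebraicGeometry.Motives.ComplexPoints

variable {X : Literature.AlgebraicGeometry.Motives.SchemeOver ℂ}

open Literature.AlgebraicGeometry.Motives.AlgPoints

/-- **`Z(ℂ) ∩ U(ℂ)` is preconnected** for `Z` irreducible closed and `U` an affine open, granted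
the coordinate fact `isConnected_zeroLocus_of_isPrime`: if `Z` meets `U` it is homeomorphic
(coordinates, `AlgPoints.isInducing_evalOrZero_val`) onto `V(J)` with `J` prime.
[cite: Shafarevich1994, Book 3 Ch. VII §2 Thm. 7.1] [cite: SGA1, Exp. XII Prop. 2.4] -/
theorem _root_.Literature.AlgebraicGeometry.Motives.ComplexPoints.isPreconnected_setOf_pt_mem_inter (hV : isConnected_zeroLocus_of_isPrime)
    [LocallyOfFiniteType X.hom] {U : X.left.Opens} (hU : IsAffineOpen U) {Z : Set X.left}
    (hZ : IsClosed Z) (hZ' : IsIrreducible Z) :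
    IsPreconnected {P : ComplexPoints X | P.pt ∈ Z ∧ P.pt ∈ U} := by
  -- if `Z ∩ U = ∅` the set is empty
  by_cases hZU : (Z ∩ (U : Set X.left)).Nonempty
  swap
  · have : {P : ComplexPoints X | P.pt ∈ Z ∧ P.pt ∈ U} = ∅ :=
      Set.eq_empty_of_forall_notMem fun P hP ↦ hZU ⟨P.pt, hP.1, hP.2⟩
    rw [this]
    exact isPreconnected_empty
  letI : Algebra ℂ Γ(X.left, U) := (Literature.AlgebraicGeometry.Motives.SchemeOver.scalarRingHom X U).toAlgebra
  have halg : ∀ c, algebraMap ℂ Γ(X.left, U) c = Literature.AlgebraicGeometry.Motives.SchemeOver.scalarRingHom X U c := fun c ↦ rfl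
  obtain ⟨n, x, hx⟩ := exists_surjective_aeval hU halg
  haveI : ((((Scheme.IdealSheafData.vanishingIdeal ⟨Z, hZ⟩).ideal ⟨U, hU⟩).comap
      (MvPolynomial.aeval x : MvPolynomial (Fin n) ℂ →ₐ[ℂ] Γ(X.left, U)))).IsPrime := by
    haveI := isPrime_ideal_vanishingIdeal hU hZ hZ' hZU
    exact Ideal.comap_isPrime _ _
  have hconn := hV _ this
  rw [← image_evalOrZero_eq_zeroLocus halg hU hx hZ] at hconn
  have hpre : IsPreconnected {P : {P : ComplexPoints X // P.pt ∈ U} | P.1.pt ∈ Z} :=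
    ((isInducing_evalOrZero_val (L := ℂ) halg hU
      (Algebra.Generators.ofSurjective x hx)).isPreconnected_image).mp hconn.isPreconnected
  have := hpre.image _ continuous_subtype_val.continuousOn
  convert this using 1
  ext P
  constructor
  · rintro ⟨hPZ, hPU⟩
    exact ⟨⟨P, hPU⟩, hPZ, rfl⟩
  · rintro ⟨Q, hQ, rfl⟩
    exact ⟨hQ, Q.2⟩

variable (X) in
/-- **The irreducible case of SGA1 XII Prop. 2.4 from the coordinate fact.** If `V(𝔭) ⊆ ℂⁿ` is
connected for every prime `𝔭` (`isConnected_zeroLocus_of_isPrime`, Shafarevich's Theorem 7.1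
for affine varieties), then for every scheme `X` locally of finite type over `ℂ` and every
irreducible closed `Z ⊆ X`, `Z(ℂ) ⊆ X(ℂ)` is connected: `Z(ℂ)` is the union over the affine opens
`U` meeting `Z` of the connected sets `Z(ℂ) ∩ U(ℂ)`, any two of which share a complex point
(`Z ∩ U ∩ U' ≠ ∅` by irreducibility, and a nonempty locally closed set has a closed point).
[cite: SGA1, Exp. XII Prop. 2.4] [cite: Shafarevich1994, Book 3 Ch. VII §2 Thm. 7.1] -/
theorem _root_.Literature.AlgebraicGeometry.Motives.ComplexPoints.isConnected_setOf_pt_mem_of_isIrreducible_of_zeroLocus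
    (hV : isConnected_zeroLocus_of_isPrime) : isConnected_setOf_pt_mem_of_isIrreducible X := by
  intro _ Z hZ hZ'
  -- affine opens meeting `Z`
  let ι : Type := {U : X.left.affineOpens // (Z ∩ (U : Set X.left)).Nonempty}
  let s : ι → Set (ComplexPoints X) := fun U ↦ {P | P.pt ∈ Z ∧ P.pt ∈ (U.1 : X.left.Opens)}
  have hs : ∀ U : ι, IsPreconnected (s U) := fun U ↦
    isPreconnected_setOf_pt_mem_inter hV U.1.2 hZ hZ'
  have hcov : {P : ComplexPoints X | P.pt ∈ Z} = ⋃ U, s U := by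
    ext P
    simp only [Set.mem_setOf_eq, Set.mem_iUnion]
    constructor
    · intro hP
      obtain ⟨W, hW, hPW, -⟩ :=
        exists_isAffineOpen_mem_and_subset (X := X.left) (x := P.pt) (U := ⊤) trivial
      exact ⟨⟨⟨W, hW⟩, P.pt, hP, hPW⟩, hP, hPW⟩
    · rintro ⟨U, hP, -⟩
      exact hP
  have K : ∀ U U' : ι, Relation.ReflTransGen (fun i j ↦ (s i ∩ s j).Nonempty) U U' := by
    intro U U'
    refine Relation.ReflTransGen.single ?_
    have hne : (Z ∩ ((U.1 : Set X.left) ∩ U'.1)).Nonempty :=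
      hZ'.2 _ _ (U.1 : X.left.Opens).isOpen (U'.1 : X.left.Opens).isOpen U.2 U'.2
    have hlc : IsLocallyClosed (Z ∩ ((U.1 : Set X.left) ∩ U'.1)) :=
      hZ.isLocallyClosed.inter
        (((U.1 : X.left.Opens).isOpen.inter (U'.1 : X.left.Opens).isOpen).isLocallyClosed)
    obtain ⟨P, hPZ, hPU, hPU'⟩ := exists_pt_mem hne hlc
    exact ⟨P, ⟨hPZ, hPU⟩, ⟨hPZ, hPU'⟩⟩
  refine ⟨?_, hcov ▸ IsPreconnected.iUnion_of_reflTransGen hs K⟩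
  obtain ⟨P, hP⟩ := exists_pt_mem hZ'.nonempty hZ.isLocallyClosed
  exact ⟨P, hP⟩

variable (X) in
/-- **SGA1 XII Prop. 2.4 from the coordinate fact**: for `X` locally of finite type over `ℂ`,
`X(ℂ)` is connected iff `X` is, granted that `V(𝔭) ⊆ ℂⁿ` is connected for prime `𝔭`.
[cite: SGA1, Exp. XII Prop. 2.4] -/
theorem _root_.Literature.AlgebraicGeometry.Motives.ComplexPoints.connectedSpace_iff_of_isConnected_zeroLocus (hV : isConnected_zeroLocus_of_isPrime) :
    connectedSpace_iff X :=
  connectedSpace_iff_of_isConnected_setOf_pt_mem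
    (@fun _ _ hZ hZ' ↦ isConnected_setOf_pt_mem_of_isIrreducible_of_zeroLocus X hV hZ hZ')

end ComplexPoints

end Literature.NumberTheory.Transcendental
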